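import Mathlib
import HarnessLib
import Summits.CriticalPhenomena.Ising3DConformalLimit.Theses.PerfectScreening

/-!
# Sketch — crux ideas for `SubharmonicOffOrigin` (stmt-CriticalPhenomena-1341), ideator 1, round 1

First lemmas of the two crux idea cards (they need not be proved here; they must elaborate):

* `planar-source-kl`: `PlanarSourceMixture → SubharmonicOffOrigin` — a positive superposition of massive free
  lattice propagators sourced on the coordinate plane `{x 0 = 0}` is lattice-subharmonic off that plane; cubic
  symmetry of `criticalTwoPoint 3` (tree: `twoPointPlus_perm_invariant_holds`) moves the plane, so the Laplacian is
  nonnegative at every `x ≠ 0`.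
* `certified-core-eventual-tail`: `SubHCoreWindow R β₁ β₂ → β₁ ≤ β_c ≤ β₂ → EventuallySubharmonicAt R → SubharmonicOffOrigin`
  (pure logic; the content is that the core is LP/SDP-certifiable uniformly on a β-window and the tail is the
  route's pre-filed `EventuallySubharmonic` with an explicit radius).
-/

namespace Summit.CriticalPhenomena.Ising3DConformalLimit.Cruxes.SubharmonicOffOrigin.Ideator1

open MeasureTheory
open Literature.Probability.LatticeModels

noncomputable section

/-- The massive lattice Green function `(s − Δ_{ℤ³})⁻¹ δ₀ (x)` of `ℤ³`, `s ≥ 0`, as an absolutely convergent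
Fourier integral over the Brillouin zone (for `s = 0` it is `latticeGreen x / 2`, cf. `GreenAsymptotics` of the
route file). -/
def massiveGreen (s : ℝ) (x : Site 3) : ℝ :=
  (∫ p in Set.pi Set.univ (fun _ : Fin 3 => Set.Icc (-Real.pi) Real.pi),
      Real.cos (∑ i, p i * (x i : ℝ)) / (s + ∑ i, 2 * (1 - Real.cos (p i)))) / (2 * Real.pi) ^ 3

/-- The transverse plane `{x 0 = 0} ≅ ℤ²` inside `ℤ³`. -/
def planeSite (y : Fin 2 → ℤ) : Site 3 := Fin.cons 0 y

/-- PLANAR-SOURCE KÄLLÉN–LEHMANN MIXTURE (crux idea `planar-source-kl`, the transfer target C⁺):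
the critical two-point function of `ℤ³` is a positive superposition of massive free lattice propagators whose
sources lie in the coordinate plane `{x 0 = 0}`:
`G(x) = Σ_{y ∈ ℤ²} ∫_{[0,∞)} massiveGreen s (x − (0,y)) dα_y(s)` with finite positive measures `α_y` carried by
`[0, ∞)`.  Spectral meaning (RP transfer-matrix calculus in direction 0): writing the mixed representation as
`Ĝ(p₀, k) = ∫ A(k, ds) / (s + p̂₀² + k̂²)`, this is (i) `supp A(k,·) ⊆ [0,∞)` = the lattice spectral condition
`E ≥ arccosh(1 + k̂²/2)` AND (ii) `k ↦ A(k, ds)` positive-definite on `𝕋²` (`α_y(ds)` = its Fourier coefficients). -/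
def PlanarSourceMixture : Prop :=
  ∃ α : (Fin 2 → ℤ) → Measure ℝ,
    (∀ y, IsFiniteMeasure (α y)) ∧ (∀ y, α y (Set.Iio 0) = 0) ∧
    (∀ x : Site 3, Summable fun y => ∫ s, massiveGreen s (x - planeSite y) ∂(α y)) ∧
    ∀ x : Site 3, criticalTwoPoint 3 x = ∑' y, ∫ s, massiveGreen s (x - planeSite y) ∂(α y)

/-- FIRST LEMMA of `planar-source-kl`: a planar-source mixture of massive free propagators is lattice-subharmonic
off the origin.  Proof sketch: `Δ massiveGreen s (· − z) = s · massiveGreen s (· − z) ≥ 0` away from `z`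
(massive Poisson identity + positivity of the massive Green function), the Laplacian stencil commutes with `∑'`/`∫`
(finite stencil, `Summable`, finite measures), so `ΔG ≥ 0` off the plane `{x 0 = 0}`; for `x ≠ 0` some coordinate
`x i ≠ 0`, and permutation invariance of `twoPointPlus` (`twoPointPlus_perm_invariant_holds`) and of `massiveGreen`
transports the representation to direction `i`. -/
theorem subharmonicOffOrigin_of_planarSourceMixture :
    PlanarSourceMixture → Theses.PerfectScreening.SubharmonicOffOrigin := by
  sorry

/-- One summand: the massive free propagator is subharmonic off its source (massive lattice Poisson identity;
the `s = 0` case is `latticeLaplacianZd_latticeGreen_of_ne_zero`). -/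
theorem massiveGreen_laplacian_nonneg (s : ℝ) (hs : 0 ≤ s) (z x : Site 3) (hx : x ≠ z) :
    6 * massiveGreen s (x - z) ≤
      ∑ i : Fin 3, (massiveGreen s (x + Pi.single i 1 - z) + massiveGreen s (x - Pi.single i 1 - z)) := by
  sorry

/-! ### Band positivity (the data-driven form of the spectral lever; see card `planar-source-kl`, §Transfer)

Transfer-matrix bands in direction 0: a band is a pair (layer kernel `K ≥ 0` on `ℤ²`, profile `φ` on `ℤ²`) and
contributes `u(n, y) = (K^{*|n|} * φ)(y)` to `G(n, y)` (`K̂ = e^{-E_b(k)}`, `φ̂ = F_b(k)` = the band form factor).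
Its full `ℤ³`-Laplacian at `n ≥ 1` is `K^{*(n-1)} * ψ` with `ψ := K*K*φ − 2K*φ + φ + Δ_⊥(K*φ)`
(`ψ̂ = F_b · e^{-E_b} · (2cosh E_b − 2 − k̂²)`), so `K ≥ 0 ∧ ψ ≥ 0` pointwise makes the band subharmonic off the
plane `n = 0` — no Fourier analysis, only convolution of nonnegative functions. -/

/-- Discrete convolution on `ℤ²` (as a `finsum`; meaningful under finite support / summability). -/
def conv2 (f g : (Fin 2 → ℤ) → ℝ) (y : Fin 2 → ℤ) : ℝ := ∑ᶠ z : Fin 2 → ℤ, f z * g (y - z)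

/-- Convolution powers `K^{*n}`, `K^{*0} = δ₀`. -/
def convPow (K : (Fin 2 → ℤ) → ℝ) : ℕ → (Fin 2 → ℤ) → ℝ
  | 0 => fun y => if y = 0 then 1 else 0
  | n + 1 => conv2 K (convPow K n)

/-- The transverse (in-plane) graph Laplacian of `ℤ²`. -/
def lapPerp (f : (Fin 2 → ℤ) → ℝ) (y : Fin 2 → ℤ) : ℝ :=
  ∑ j : Fin 2, (f (y + Pi.single j 1) + f (y - Pi.single j 1)) - 4 * f y

/-- The band function `u(n, y) = (K^{*|n|} * φ)(y)` on `ℤ × ℤ² = ℤ³`. -/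
def bandFun (K φ : (Fin 2 → ℤ) → ℝ) (n : ℤ) (y : Fin 2 → ℤ) : ℝ := conv2 (convPow K n.natAbs) φ y

/-- The Laplacian weight `ψ = K*K*φ − 2 K*φ + φ + Δ_⊥(K*φ)` of a band. -/
def bandPsi (K φ : (Fin 2 → ℤ) → ℝ) (y : Fin 2 → ℤ) : ℝ :=
  conv2 K (conv2 K φ) y - 2 * conv2 K φ y + φ y + lapPerp (conv2 K φ) y

/-- BAND LEMMA (first checkable statement of the refined spectral line): a band with nonnegative layer kernel and
nonnegative Laplacian weight is lattice-subharmonic at every site off the source plane `n = 0`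
(finitely supported data, so all convolutions are finite sums). -/
theorem band_subharmonic_off_plane (K φ : (Fin 2 → ℤ) → ℝ) (S : Finset (Fin 2 → ℤ))
    (hKS : ∀ y ∉ S, K y = 0) (hφS : ∀ y ∉ S, φ y = 0) (hK : ∀ y, 0 ≤ K y) (hψ : ∀ y, 0 ≤ bandPsi K φ y)
    (n : ℤ) (hn : n ≠ 0) (y : Fin 2 → ℤ) :
    6 * bandFun K φ n y ≤
      bandFun K φ (n + 1) y + bandFun K φ (n - 1) y +
        ∑ j : Fin 2, (bandFun K φ n (y + Pi.single j 1) + bandFun K φ n (y - Pi.single j 1)) := by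
  sorry

/-- BAND DECOMPOSITION of the critical two-point function in direction 0 (countably many bands, finitely
supported for simplicity of the sketch; the spectral statement replaces finite support by summability):
`G(n, y) = Σ_b u_b(n, y)` with every band positive in the sense of the band lemma.  Spectrally: per band,
LSC on the support of `F_b` (from `Σ_y ψ_b(y) ≥ 0`-type sum rules), the one-layer band
propagator `e^{-E_b(k)}` is positive-definite in `k` (`K_b ≥ 0`), and `F_b(k)·e^{-E_b(k)}·s_b(k)` is
positive-definite in `k` (`ψ_b ≥ 0`). -/
def BandDecomposition : Prop :=
  ∃ (K φ : ℕ → (Fin 2 → ℤ) → ℝ) (S : ℕ → Finset (Fin 2 → ℤ)),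
    (∀ b, ∀ y ∉ S b, K b y = 0) ∧ (∀ b, ∀ y ∉ S b, φ b y = 0) ∧ (∀ b y, 0 ≤ K b y) ∧ (∀ b y, 0 ≤ bandPsi (K b) (φ b) y) ∧
    (∀ (n : ℤ) (y : Fin 2 → ℤ), Summable fun b => bandFun (K b) (φ b) n y) ∧
    ∀ (n : ℤ) (y : Fin 2 → ℤ), criticalTwoPoint 3 (Fin.cons n y) = ∑' b, bandFun (K b) (φ b) n y

/-- `BandDecomposition → SubharmonicOffOrigin`: off the plane by the band lemma and `tsum` of nonnegative terms;
on the plane minus the origin by permutation invariance of `criticalTwoPoint 3`. -/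
theorem subharmonicOffOrigin_of_bandDecomposition :
    BandDecomposition → Theses.PerfectScreening.SubharmonicOffOrigin := by
  sorry

/-- SHORT-DISTANCE CORE ON A β-WINDOW (crux idea `certified-core-eventual-tail`): the plus-state two-point
function is lattice-subharmonic at every `0 < ‖x‖ ≤ R` for every `β ∈ [β₁, β₂]` — the shape of statement a lattice
positivity-bootstrap certificate (DLR identities + reflection positivity + symmetry + Griffiths, dualised) proves
with interval arithmetic, `β_c(3)` being known only to lie in a window. -/
def SubHCoreWindow (R β₁ β₂ : ℝ) : Prop :=
  ∀ β : ℝ, β₁ ≤ β → β ≤ β₂ → ∀ x : Site 3, x ≠ 0 → ‖x‖ ≤ R →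
    6 * twoPointPlus 3 β x ≤ ∑ i : Fin 3, (twoPointPlus 3 β (x + Pi.single i 1) + twoPointPlus 3 β (x - Pi.single i 1))

/-- The route's pre-filed tail statement with an explicit radius (`EventuallySubharmonic` is `∃ R, …`). -/
def EventuallySubharmonicAt (R : ℝ) : Prop :=
  ∀ x : Site 3, R < ‖x‖ →
    6 * criticalTwoPoint 3 x ≤ ∑ i : Fin 3, (criticalTwoPoint 3 (x + Pi.single i 1) + criticalTwoPoint 3 (x - Pi.single i 1))

/-- FIRST LEMMA of `certified-core-eventual-tail` (pure logic): a certified core on a window containing `β_c(3)`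
plus the eventual tail at the same radius is the crux. -/
theorem subharmonicOffOrigin_of_core_of_tail (R β₁ β₂ : ℝ) (hcore : SubHCoreWindow R β₁ β₂)
    (h₁ : β₁ ≤ criticalBeta 3) (h₂ : criticalBeta 3 ≤ β₂) (htail : EventuallySubharmonicAt R) :
    Theses.PerfectScreening.SubharmonicOffOrigin := by
  intro x hx
  rcases le_or_gt ‖x‖ R with hR | hR
  · simpa [criticalTwoPoint] using hcore (criticalBeta 3) h₁ h₂ x hx hR
  · exact htail x hR

/-- The tail implies the route's support item `EventuallySubharmonic` (sanity link). -/
theorem eventuallySubharmonic_of_at (R : ℝ) (h : EventuallySubharmonicAt R) :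
    Theses.PerfectScreening.EventuallySubharmonic := ⟨R, h⟩

end

end Summit.CriticalPhenomena.Ising3DConformalLimit.Cruxes.SubharmonicOffOrigin.Ideator1
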